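import Mathlib
import Summits.Ventures.HodgeRepro2.T6N5SignModelCMDisplays
import Summits.Ventures.HodgeRepro2.T6N5FockLiMain

/-!
# T6N5SignModelCMDisplaysLi — t6-p8's host-shaped statement of rows 183–184 with the real-place hypotheses from the
displays in the (C) FORM: Li 1990 (32) on the Li carriers (deposited journal print) in place of KK07 Theorem 5.4(i)
(print pending W-11) — Tier 6, M2 sub-step N5 (t6-p7), proof lane

`exists_signModel_ofGlobal_displays` / `exists_signModel_ofCM_displays` (T6N5SignModelCMDisplays) with the real-place
bundle in the (C) form (`RealPlaceBundleLi`, T6N5FockLiMain: the Li carriers, the direction units and the bridge facts as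
declared EX fields) and the display binders `Hyp.Li1990_eq32_lines` (PRINT) + `Hyp.KonnoKonno2007_Fact5_1_compact`
(held print layer) + the restricted Epsilon Dichotomy — no print-pending display at the real places, IR 0; and the
PLACE-FAMILY-LEVEL forms `PlaceFamily.signModel_realCondB_displays_Li` / `solves_realCondB_of_eq_displays_Li` (the
₃-shaped rows 183–184 of t6-p8's OPTION A, the lead's (iii) at STATUS l. 12851).  Non-vacuity on any CM field:
`cm_global_witness_displays_Li` (t6-p8's toy family, this lane's (C)-form toy bundle).
§8(d): uses an L-value-free non-vanishing device: NO.
-/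

namespace Summit.Ventures.HodgeRepro2.T6.N5LocalSignModel.PlaceFamily

open Summit.Ventures.HodgeRepro2.T6.N5LocalDatum Summit.Ventures.HodgeRepro2.T6.N5Rich
  Summit.Ventures.HodgeRepro2.T6.Hyp Summit.Ventures.HodgeRepro2.T6.N5RealPlace
  Summit.Ventures.HodgeRepro2.T6.N5LocalSignModel

noncomputable section

variable {K : Type} [Field K] [NumberField K] {L : Type} [Field L] [NumberField L] [Algebra K L]
  {ι : Type*} (F : PlaceFamily K L ι)

/-- `hre` FROM THE DISPLAYS BY NAME IN THE (C) FORM at the level of the place family: the (C)-form real-place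
bundle over the places and, at every real place of both sides, the restricted Epsilon Dichotomy, Li (32) on the
Li carrier and KK07 Fact 5.1 on the KK07 carrier — no print-pending display. -/
theorem signModel_realCondB_displays_Li (hF : F.Hyps) (RP : N5Fock.RealPlaceBundleLi ι)
    (h35A : ∀ v, F.kind v = PlaceKind.re → BFGYYZ2025_Thm3_5_smooth (RP.RA v).toLocal (fun _ => True))
    (h35B : ∀ v, F.kind v = PlaceKind.re → BFGYYZ2025_Thm3_5_smooth (RP.RB v).toLocal (fun _ => True))
    (hLiA : ∀ v, F.kind v = PlaceKind.re → Li1990_eq32_lines (RP.LA v))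
    (hLiB : ∀ v, F.kind v = PlaceKind.re → Li1990_eq32_lines (RP.LB v))
    (h51A : ∀ v, F.kind v = PlaceKind.re → KonnoKonno2007_Fact5_1_compact (RP.CA v))
    (h51B : ∀ v, F.kind v = PlaceKind.re → KonnoKonno2007_Fact5_1_compact (RP.CB v)) :
    (F.signModel hF RP.RA RP.RB).RealCondB :=
  F.signModel_realCondB_CO hF RP.RA RP.RB
    (fun v hv => N5Fock.thm3_5_of_smooth_true _ (h35A v hv))
    (fun v hv => N5Fock.thm3_5_of_smooth_true _ (h35B v hv))
    (fun v hv => RP.fockDictCO_A v (hLiA v hv) (h51A v hv))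
    (fun v hv => RP.fockDictCO_B v (hLiB v hv) (h51B v hv))
    (fun v _ i => RP.hHA v i) (fun v _ i => RP.hHB v i)

/-- `hsol ∧ hre` for any rich datum whose sign model is the place family's on the (C)-form bundle's real data, from
the displays by name — the ₃-shaped rows 183–184 of t6-p8's OPTION A with IR 0 at the real places and no
print-pending display (the lead's (iii), STATUS l. 12851). -/
theorem solves_realCondB_of_eq_displays_Li {G : Type*} [CommGroup G] (R : RichData ι G) (hF : F.Hyps)
    (RP : N5Fock.RealPlaceBundleLi ι) (hS : R.S = F.signModel hF RP.RA RP.RB)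
    (h35A : ∀ v, F.kind v = PlaceKind.re → BFGYYZ2025_Thm3_5_smooth (RP.RA v).toLocal (fun _ => True))
    (h35B : ∀ v, F.kind v = PlaceKind.re → BFGYYZ2025_Thm3_5_smooth (RP.RB v).toLocal (fun _ => True))
    (hLiA : ∀ v, F.kind v = PlaceKind.re → Li1990_eq32_lines (RP.LA v))
    (hLiB : ∀ v, F.kind v = PlaceKind.re → Li1990_eq32_lines (RP.LB v))
    (h51A : ∀ v, F.kind v = PlaceKind.re → KonnoKonno2007_Fact5_1_compact (RP.CA v))
    (h51B : ∀ v, F.kind v = PlaceKind.re → KonnoKonno2007_Fact5_1_compact (RP.CB v)) :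
    R.S.Solves ∧ R.S.RealCondB := by
  rw [hS]
  exact ⟨F.signModel_solves hF RP.RA RP.RB,
    F.signModel_realCondB_displays_Li hF RP h35A h35B hLiA hLiB h51A h51B⟩

end

end Summit.Ventures.HodgeRepro2.T6.N5LocalSignModel.PlaceFamily

namespace Summit.Ventures.HodgeRepro2.T6.N5LocalSignModelGlobal

open Summit.Ventures.HodgeRepro2 IsDedekindDomain HeightOneSpectrum
  Summit.Ventures.HodgeRepro2.T6.N5LocalDatum Summit.Ventures.HodgeRepro2.T6.N5Rich
  Summit.Ventures.HodgeRepro2.T6.Hyp Summit.Ventures.HodgeRepro2.T6.N5RealPlace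
  Summit.Ventures.HodgeRepro2.T6.N5LocalSignModel Summit.Ventures.HodgeRepro2.T6.N5Fock

noncomputable section

section Global

variable {K : Type} [Field K] [NumberField K] {L : Type} [Field L] [NumberField L] [Algebra K L]
  (hKL : Module.finrank K L = 2) (T : ThreeDataFamily K L)

/-- `exists_signModel_ofGlobal` with the real-place hypotheses from the displays in the (C) form: the (C)-form
bundle over the places of `K` and, at every real place of both sides, the restricted Epsilon Dichotomy, Li (32) on
the Li carrier and KK07 Fact 5.1 on the KK07 carrier. -/
theorem exists_signModel_ofGlobal_displays_Li
    (hT : ∀ (v : HeightOneSpectrum (NumberField.RingOfIntegers K)) (h : IsNonSplit K L v),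
      (localInputAt hKL T h).Hyps)
    (RP : RealPlaceBundleLi (GlobalIndex K))
    (h35A : ∀ τ : {τ : NumberField.InfinitePlace K // τ.IsReal},
      BFGYYZ2025_Thm3_5_smooth (RP.RA (Sum.inr τ)).toLocal (fun _ => True))
    (h35B : ∀ τ : {τ : NumberField.InfinitePlace K // τ.IsReal},
      BFGYYZ2025_Thm3_5_smooth (RP.RB (Sum.inr τ)).toLocal (fun _ => True))
    (hLiA : ∀ τ : {τ : NumberField.InfinitePlace K // τ.IsReal}, Li1990_eq32_lines (RP.LA (Sum.inr τ)))
    (hLiB : ∀ τ : {τ : NumberField.InfinitePlace K // τ.IsReal}, Li1990_eq32_lines (RP.LB (Sum.inr τ)))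
    (h51A : ∀ τ : {τ : NumberField.InfinitePlace K // τ.IsReal}, KonnoKonno2007_Fact5_1_compact (RP.CA (Sum.inr τ)))
    (h51B : ∀ τ : {τ : NumberField.InfinitePlace K // τ.IsReal}, KonnoKonno2007_Fact5_1_compact (RP.CB (Sum.inr τ))) :
    ∃ S : SignModel (GlobalIndex K), S.kind = kindOf K L ∧ S.D = (PlaceFamily.ofGlobal hKL T).D ∧
      S.Solves ∧ S.RealCondB :=
  exists_signModel_ofGlobal_CO hKL T hT RP.RA RP.RB
    (fun τ => thm3_5_of_smooth_true _ (h35A τ)) (fun τ => thm3_5_of_smooth_true _ (h35B τ))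
    (fun τ => RP.fockDictCO_A (Sum.inr τ) (hLiA τ) (h51A τ))
    (fun τ => RP.fockDictCO_B (Sum.inr τ) (hLiB τ) (h51B τ))
    (fun τ => RP.hHA (Sum.inr τ)) (fun τ => RP.hHB (Sum.inr τ))

end Global

end

end Summit.Ventures.HodgeRepro2.T6.N5LocalSignModelGlobal

namespace Summit.Ventures.HodgeRepro2.T6.N5LocalSignModelCM

open Summit.Ventures.HodgeRepro2 IsDedekindDomain HeightOneSpectrum NumberField
  Summit.Ventures.HodgeRepro2.T6.N5LocalDatum Summit.Ventures.HodgeRepro2.T6.N5Rich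
  Summit.Ventures.HodgeRepro2.T6.Hyp Summit.Ventures.HodgeRepro2.T6.N5RealPlace
  Summit.Ventures.HodgeRepro2.T6.N5LocalSignModel Summit.Ventures.HodgeRepro2.T6.N5LocalSignModelGlobal
  Summit.Ventures.HodgeRepro2.T6.N5Fock

noncomputable section

section CM

variable (E : Type) [Field E] [NumberField E] [IsCMField E]

/-- THE HOST-SHAPED STATEMENT OF ROWS 183–184 ON A CM FIELD, real-place hypotheses from the displays in the (C)
form — no print-pending display. -/
theorem exists_signModel_ofCM_displays_Li (T : ThreeDataFamily (maximalRealSubfield E) E)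
    (hT : ∀ (v : HeightOneSpectrum (RingOfIntegers (maximalRealSubfield E)))
      (h : IsNonSplit (maximalRealSubfield E) E v),
      (localInputAt (finrank_maximalRealSubfield_eq_two E) T h).Hyps)
    (RP : RealPlaceBundleLi (GlobalIndex (maximalRealSubfield E)))
    (h35A : ∀ τ : {τ : InfinitePlace (maximalRealSubfield E) // τ.IsReal},
      BFGYYZ2025_Thm3_5_smooth (RP.RA (Sum.inr τ)).toLocal (fun _ => True))
    (h35B : ∀ τ : {τ : InfinitePlace (maximalRealSubfield E) // τ.IsReal},
      BFGYYZ2025_Thm3_5_smooth (RP.RB (Sum.inr τ)).toLocal (fun _ => True))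
    (hLiA : ∀ τ : {τ : InfinitePlace (maximalRealSubfield E) // τ.IsReal}, Li1990_eq32_lines (RP.LA (Sum.inr τ)))
    (hLiB : ∀ τ : {τ : InfinitePlace (maximalRealSubfield E) // τ.IsReal}, Li1990_eq32_lines (RP.LB (Sum.inr τ)))
    (h51A : ∀ τ : {τ : InfinitePlace (maximalRealSubfield E) // τ.IsReal},
      KonnoKonno2007_Fact5_1_compact (RP.CA (Sum.inr τ)))
    (h51B : ∀ τ : {τ : InfinitePlace (maximalRealSubfield E) // τ.IsReal},
      KonnoKonno2007_Fact5_1_compact (RP.CB (Sum.inr τ))) :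
    ∃ S : SignModel (GlobalIndex (maximalRealSubfield E)),
      S.kind = kindOf (maximalRealSubfield E) E ∧ S.D = (PlaceFamily.ofCM E T).D ∧ S.Solves ∧ S.RealCondB :=
  exists_signModel_ofGlobal_displays_Li (finrank_maximalRealSubfield_eq_two E) T hT RP h35A h35B hLiA hLiB
    h51A h51B

end CM

end

end Summit.Ventures.HodgeRepro2.T6.N5LocalSignModelCM

namespace Summit.Ventures.HodgeRepro2.T6.N5LocalSignModelCMWitness

open Summit.Ventures.HodgeRepro2 IsDedekindDomain HeightOneSpectrum NumberField
  Summit.Ventures.HodgeRepro2.T6.N5Rich Summit.Ventures.HodgeRepro2.T6.N5RealPlace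
  Summit.Ventures.HodgeRepro2.T6.N5LocalSignModel Summit.Ventures.HodgeRepro2.T6.N5LocalSignModelGlobal
  Summit.Ventures.HodgeRepro2.T6.N5LocalSignModelGlobalWitness Summit.Ventures.HodgeRepro2.T6.N5LocalSignModelCM
  Summit.Ventures.HodgeRepro2.T6.N5Fock

noncomputable section

section AnyCM

variable (E : Type) [Field E] [NumberField E] [IsCMField E]

/-- The CM witness through the (C)-form displays on any CM field: t6-p8's toy family and this lane's (C)-form toy
bundle with the three displays on it. -/
theorem cm_global_witness_displays_Li :
    ∃ S : SignModel (GlobalIndex (maximalRealSubfield E)), S.kind = kindOf (maximalRealSubfield E) E ∧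
      S.D = (PlaceFamily.ofCM E (toyFamilyCM E)).D ∧ S.Solves ∧ S.RealCondB :=
  exists_signModel_ofCM_displays_Li E (toyFamilyCM E) (toyFamilyCM_hyps E) (N5Fock.Toy.bundleLi _)
    (fun _ => N5Fock.Toy.toyReal₁_thm3_5_smooth) (fun _ => N5Fock.Toy.toyReal₁_thm3_5_smooth)
    (fun _ => N5Fock.Toy.liCarrier_eq32) (fun _ => N5Fock.Toy.liCarrier_eq32)
    (fun _ => N5Fock.Toy.carrier_howeCompact) (fun _ => N5Fock.Toy.carrier_howeCompact)

end AnyCM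

end

end Summit.Ventures.HodgeRepro2.T6.N5LocalSignModelCMWitness
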